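import Summits.QuantumFields.YangMills.Theorems.BalabanUVNodesN15KingModelHeatKernelBlockGeometry
import HarnessLib

/-!
# BalabanUVNodes ∕ N15 — THE KING-MODEL RUNG (PART Ϻ-c): THE FAR ZONE OF THE INVERSE-SQUARE LAW FOR KING's FULL PROPAGATOR — blocks `D = dist_M(β_u,β_v) ≥ 6` apart:
# `L²·|A₀⁻¹(u,v) − G(u,v)| ≤ (98·C₀·C_Δ·S_κ∕m² + 50·C_Δ∕(κ_A²m⁴))∕(1 + dist(u,v)²)` on `(ℤ∕LM₀)⁴`, every `L ≥ 1`, every `M₀ ≥ 1` (`C₀ = 34016 + 10∕m²`, `C_Δ = CDelta a 4`, `κ_A = kapA a 4`, `S_κ = latticeConst 4 κ_A`);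
# and the NEAR ZONE `D < 6`: `L²·|A₀⁻¹(u,v) − G(u,v)| ≤ 50·C_Δ∕(m⁴(1 + dist(u,v)²))`
# (Track A, DAG node N15 = NE2; FAN-OUT v1.1 §N15 s3 «KING-MODEL RUNG … + what the curved case adds»; count-neutral)

HONEST FRAMING.  Count-neutral (cell `pub-ymgap`, seat `pub-ymgap-dag-n15-e` g56; `--supports stmt-QuantumFields-27247 --as helper` = K3ᴬ).  King's `A = 0` one-level comparison model at King's scaling `c = L²` on
the cubic fine four-torus `Tor (fine L (cM M₀)) = (ℤ∕LM₀)⁴` with blocks `Tor (cM M₀) = (ℤ∕M₀)⁴` ([King1986] (2.13)–(2.14) p.653, (4.1)–(4.5) p.670): `G = (L²(−Δ)+m²)⁻¹`, `A₀ = L²(−Δ)+m²+aQ^*Q` (`fineOp`),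
`Δ_eff` (`effLaplacian`).  Ϻ-a wrote `A₀⁻¹(u,v) − G(u,v) = −L^{−4}Σ_{b,b′}S_u(b)Δ_eff(b,b′)S^v(b′)` with non-negative block row∕column sums `S_u`, `S^v` of total mass `1∕m²`; THIS FILE bounds the double sum
when the blocks `β_u ∋ u`, `β_v ∋ v` are `D ≥ 6` apart, by the THREE-LEG SPLIT (Ϻ-b): for every pair `(b,b′)` one of `dist(β_u,b)`, `dist(b,b′)`, `dist(b′,β_v)` is `≥ D∕3`, and accordingly
(A) `|Δ_eff(b,b′)| ≤ C_Δe^{−κ_AD∕3}` (King (4.34)(ii) `effLaplacian_decay`), or (B) `S_u(b) ≤ L⁴·49C₀∕(L²(1+dist(u,v)²))` (PART Ϣ-j's `L²|G(u,x)| ≤ C₀∕(1+dist(u,x)²)` on the `L⁴` sites of a block at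
fine distance `≥ LD∕6`), or (C) the same for `S^v(b′)`; summing, `Σ_b|Δ_eff(b,b′)| ≤ C_ΔS_κ` (Ϻ-b) and `ΣS = 1∕m²` (Ϻ-a) give the three totals `C_Δe^{−κ_AD∕3}∕m⁴`, `49C₀C_ΔS_κ∕(L²m²(1+dist²))` (twice);
Ϻ-b's `exp_tail_le_far` converts the first (`÷ L⁴`, `× L²`) into `50C_Δ∕(κ_A²m⁴(1+dist²))`.
* §1 ★★ `blockSum_lapF_inv_le_far`∕`…_col_le_far` (the far-leg bound (B)∕(C) on a block row∕column sum); ★ `abs_effLaplacian_le_far` ((A));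
* §2 ★★ **`summand_le_three_terms`** (the pointwise domination `S_u(b)|Δ(b,b′)|S^v(b′) ≤ T_A + T_B + T_C` for `D ≥ 6`), ★★★ **`abs_doubleSum_le_far`** (the summed bound);
* §3 ★★★ **`mul_abs_fineOp_inv_sub_lapF_inv_le_far`** (`D ≥ 6`: `L²|A₀⁻¹(u,v) − G(u,v)| ≤ (98C₀C_ΔS_κ∕m² + 50C_Δ∕(κ_A²m⁴))∕(1+dist(u,v)²)`), ★★★ **`mul_abs_fineOp_inv_sub_lapF_inv_le_near`** (`D < 6`:
  `≤ 50C_Δ∕(m⁴(1+dist(u,v)²))`, Ϻ-a's near bound through Ϻ-b's `inv_sq_le_near`).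
HONEST SCOPE: cubic four-torus, `d+1 = 4` only (PART Ϣ); `c = L²`; crude absolute constants; NOT Bałaban's `G_k(U)` ∕ (3.42); NOT a node discharge (N15 of record untouched); nothing continuum ∕ ℝ⁴ ∕ OS ∕
mass gap ∕ Clay.
PRIOR TREE ART (by name): Ϻ-a (`fineOp_inv_apply_eq`, `blockSum_lapF_inv_nonneg`∕`_col_nonneg`, `sum_blockSum_lapF_inv_row`∕`_col`, `abs_fineOp_inv_sub_lapF_inv_le_near`), Ϻ-b (`mul_tdistT_blockOf_le`,
`exists_leg_ge_third`, `sum_abs_effLaplacian_le`∕`_le'`, `inv_sq_le_near`, `one_div_leg_le_far`, `exp_tail_le_far`), R-a `Curved.tdistT_fine_le_blocks`, Ϣ-j `king_green_powerLaw_tdistT`, King1986.Torus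
`effLaplacian_decay`, `CDelta`, `kapA`, `blockSum`, `site`, `blockOf`, `tdistT_symm`, `tdistT_nonneg`; Ν-a `lapF_inv_comm`; `Beta.WoodburyFibre.cM`; B4Sect5Proof `latticeConst`.  Dedup (rg at filing): basename 0
files; needles `blockSum_lapF_inv_le_far|summand_le_three_terms|abs_doubleSum_le_far|mul_abs_fineOp_inv_sub_lapF_inv_le_far|mul_abs_fineOp_inv_sub_lapF_inv_le_near` 0 tree files.  presearch: n/a (composition of
in-tree theorems).  Locators: [King1986] (2.13)–(2.14) p.653, (4.1)–(4.5) p.670, (4.34) p.674, (4.44)–(4.45) p.675; [Dimock2013] App. D Lemma 30; [Balaban1983RegularityDecay] §5 p.600.  0 `sorry`, 0 `def`.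
-/

noncomputable section

open Real Finset
open scoped BigOperators

namespace Summit.QuantumFields.YangMills.BalabanUVNodes.N15KingModelRung.HeatKernel

open Literature.MathematicalPhysics.QuantumFieldTheory.Balaban1983to89.B5Prop11Plancherel (Tor fine)
open Literature.MathematicalPhysics.QuantumFieldTheory.Balaban1983to89.Beta.WoodburyFibre (cM)
open Literature.MathematicalPhysics.QuantumFieldTheory.Balaban1983to89 (B4Sect5Proof.latticeConst)
open Literature.MathematicalPhysics.QuantumFieldTheory.King1986.Torus
  (lapF fineOp effLaplacian blockSum site blockOf tdistT tdistT_nonneg tdistT_symm effLaplacian_decay CDelta kapA kapA_pos CDelta_pos)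
open Summit.QuantumFields.YangMills.BalabanUVNodes.N15KingModelRung.TorusSpectral (lapF_inv_comm)
open Summit.QuantumFields.YangMills.BalabanUVNodes.N15KingModelRung.Curved (tdistT_fine_le_blocks)

variable (L M₀ : ℕ) [NeZero L] [NeZero M₀] {a m2 : ℝ}

/-! ## §1 The three legs -/

omit [NeZero L] in
/-- `|Fin 4 → Fin L| = L⁴`. [folklore] -/
theorem card_offsets_four : (Fintype.card (Fin 4 → Fin L) : ℝ) = (L : ℝ) ^ 4 := by
  rw [Fintype.card_fun, Fintype.card_fin, Fintype.card_fin]; push_cast; ring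

/-- ★★ THE FAR-LEG BOUND ON A BLOCK ROW-SUM (leg (B)): if the blocks `β_u ∋ u`, `β_v ∋ v` are `D ≥ 6` apart and `dist_M(β_u,b) ≥ D∕3`, then `S_u(b) = Σ_{x∈B(b)}G(u,x) ≤ L⁴·(49C₀∕L²)∕(1+dist(u,v)²)`
(`C₀ = 34016 + 10∕m²`; PART Ϣ-j on each of the `L⁴` sites of `B(b)`, all at fine distance `≥ LD∕6` from `u`). [cite: King1986, (2.13) p.653, (4.4) p.670, (4.35) p.674] -/
theorem blockSum_lapF_inv_le_far (hm : 0 < m2) (u v : Tor (fine L (cM M₀))) (b : Tor (cM M₀))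
    (hD : 6 ≤ tdistT (cM M₀) (blockOf L (cM M₀) u) (blockOf L (cM M₀) v))
    (hleg : tdistT (cM M₀) (blockOf L (cM M₀) u) (blockOf L (cM M₀) v) / 3 ≤ tdistT (cM M₀) (blockOf L (cM M₀) u) b) :
    blockSum L (cM M₀) (fun x => (lapF (fine L (cM M₀)) ((L : ℝ) ^ 2) m2)⁻¹ u x) b
      ≤ (L : ℝ) ^ 4 * ((49 * (34016 + 10 / m2) / (L : ℝ) ^ 2) / (1 + tdistT (fine L (cM M₀)) u v ^ 2)) := by
  have hL1 : (1 : ℝ) ≤ L := by exact_mod_cast Nat.one_le_iff_ne_zero.mpr (NeZero.ne L)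
  have hL2 : (0 : ℝ) < (L : ℝ) ^ 2 := by positivity
  have ht0 := tdistT_nonneg (fine L (cM M₀)) u v
  have ht := tdistT_fine_le_blocks L (cM M₀) u v
  have hterm : ∀ j : Fin 4 → Fin L, (lapF (fine L (cM M₀)) ((L : ℝ) ^ 2) m2)⁻¹ u (site L (cM M₀) b j)
      ≤ (49 * (34016 + 10 / m2) / (L : ℝ) ^ 2) / (1 + tdistT (fine L (cM M₀)) u v ^ 2) := by
    intro j
    have hs := mul_tdistT_blockOf_le L (cM M₀) u b j
    have hpl := king_green_powerLaw_tdistT L M₀ hm u (site L (cM M₀) b j)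
    have hleg' := one_div_leg_le_far (s := tdistT (fine L (cM M₀)) u (site L (cM M₀) b j)) hL1 hD hleg (by linarith) ht0 ht
    have hC0 : 0 ≤ (34016 + 10 / m2 : ℝ) := by positivity
    calc (lapF (fine L (cM M₀)) ((L : ℝ) ^ 2) m2)⁻¹ u (site L (cM M₀) b j)
        ≤ |(lapF (fine L (cM M₀)) ((L : ℝ) ^ 2) m2)⁻¹ u (site L (cM M₀) b j)| := le_abs_self _
      _ ≤ ((34016 + 10 / m2) / (1 + tdistT (fine L (cM M₀)) u (site L (cM M₀) b j) ^ 2)) / (L : ℝ) ^ 2 := by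
          rw [le_div_iff₀ hL2, mul_comm]; exact hpl
      _ = ((34016 + 10 / m2) / (L : ℝ) ^ 2) * (1 / (1 + tdistT (fine L (cM M₀)) u (site L (cM M₀) b j) ^ 2)) := by ring
      _ ≤ ((34016 + 10 / m2) / (L : ℝ) ^ 2) * (49 / (1 + tdistT (fine L (cM M₀)) u v ^ 2)) := mul_le_mul_of_nonneg_left hleg' (by positivity)
      _ = (49 * (34016 + 10 / m2) / (L : ℝ) ^ 2) / (1 + tdistT (fine L (cM M₀)) u v ^ 2) := by ring
  calc blockSum L (cM M₀) (fun x => (lapF (fine L (cM M₀)) ((L : ℝ) ^ 2) m2)⁻¹ u x) b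
      = ∑ j : Fin 4 → Fin L, (lapF (fine L (cM M₀)) ((L : ℝ) ^ 2) m2)⁻¹ u (site L (cM M₀) b j) := rfl
    _ ≤ ∑ _j : Fin 4 → Fin L, (49 * (34016 + 10 / m2) / (L : ℝ) ^ 2) / (1 + tdistT (fine L (cM M₀)) u v ^ 2) := Finset.sum_le_sum fun j _ => hterm j
    _ = (L : ℝ) ^ 4 * ((49 * (34016 + 10 / m2) / (L : ℝ) ^ 2) / (1 + tdistT (fine L (cM M₀)) u v ^ 2)) := by
        rw [Finset.sum_const, Finset.card_univ, nsmul_eq_mul, card_offsets_four]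

/-- ★★ THE FAR-LEG BOUND ON A BLOCK COLUMN-SUM (leg (C)): if `dist_M(b′,β_v) ≥ D∕3` then `S^v(b′) = Σ_{x∈B(b′)}G(x,v) ≤ L⁴·(49C₀∕L²)∕(1+dist(u,v)²)`. [cite: King1986, (2.13) p.653, (4.4) p.670, (4.35) p.674] -/
theorem blockSum_lapF_inv_col_le_far (hm : 0 < m2) (u v : Tor (fine L (cM M₀))) (b' : Tor (cM M₀))
    (hD : 6 ≤ tdistT (cM M₀) (blockOf L (cM M₀) u) (blockOf L (cM M₀) v))
    (hleg : tdistT (cM M₀) (blockOf L (cM M₀) u) (blockOf L (cM M₀) v) / 3 ≤ tdistT (cM M₀) b' (blockOf L (cM M₀) v)) :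
    blockSum L (cM M₀) (fun x => (lapF (fine L (cM M₀)) ((L : ℝ) ^ 2) m2)⁻¹ x v) b'
      ≤ (L : ℝ) ^ 4 * ((49 * (34016 + 10 / m2) / (L : ℝ) ^ 2) / (1 + tdistT (fine L (cM M₀)) u v ^ 2)) := by
  have e : (fun x => (lapF (fine L (cM M₀)) ((L : ℝ) ^ 2) m2)⁻¹ x v) = fun x => (lapF (fine L (cM M₀)) ((L : ℝ) ^ 2) m2)⁻¹ v x :=
    funext fun x => lapF_inv_comm (fine L (cM M₀)) _ m2 x v
  rw [e, tdistT_symm (fine L (cM M₀)) u v]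
  rw [tdistT_symm (cM M₀) b'] at hleg
  rw [tdistT_symm (cM M₀)] at hD hleg
  exact blockSum_lapF_inv_le_far L M₀ hm v u b' hD hleg

/-- ★ LEG (A): if `dist_M(b,b′) ≥ D∕3` then `|Δ_eff(b,b′)| ≤ C_Δ·e^{−κ_A·D∕3}`. [cite: King1986, (4.34) p.674; Dimock2013, App. D Lemma 30] -/
theorem abs_effLaplacian_le_far (ha : 0 < a) (hm : 0 < m2) {D : ℝ} (b b' : Tor (cM M₀)) (hleg : D / 3 ≤ tdistT (cM M₀) b b') :
    |effLaplacian L (cM M₀) a ((L : ℝ) ^ 2) m2 b b'| ≤ CDelta a 4 * Real.exp (-(kapA a 4 * (D / 3))) := by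
  refine (effLaplacian_decay L (cM M₀) ha hm b b').trans (mul_le_mul_of_nonneg_left ?_ (CDelta_pos ha 4).le)
  exact Real.exp_le_exp.mpr (by nlinarith [kapA_pos ha 4])

/-! ## §2 The three-term domination and its sum -/

/-- ★★ **THE POINTWISE THREE-TERM DOMINATION** (`D = dist_M(β_u,β_v) ≥ 6`): for every pair of blocks `(b,b′)`,
`S_u(b)|Δ_eff(b,b′)|S^v(b′) ≤ S_u(b)·C_Δe^{−κ_AD∕3}·S^v(b′) + β·|Δ_eff(b,b′)|·S^v(b′) + S_u(b)·|Δ_eff(b,b′)|·β` with `β = L⁴·(49C₀∕L²)∕(1+dist(u,v)²)` — whichever leg is long pays.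
[cite: King1986, (4.34) p.674, (4.44)–(4.45) p.675] -/
theorem summand_le_three_terms (ha : 0 < a) (hm : 0 < m2) (u v : Tor (fine L (cM M₀))) (hD : 6 ≤ tdistT (cM M₀) (blockOf L (cM M₀) u) (blockOf L (cM M₀) v))
    (b b' : Tor (cM M₀)) :
    blockSum L (cM M₀) (fun x => (lapF (fine L (cM M₀)) ((L : ℝ) ^ 2) m2)⁻¹ u x) b * |effLaplacian L (cM M₀) a ((L : ℝ) ^ 2) m2 b b'|
        * blockSum L (cM M₀) (fun x => (lapF (fine L (cM M₀)) ((L : ℝ) ^ 2) m2)⁻¹ x v) b'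
      ≤ blockSum L (cM M₀) (fun x => (lapF (fine L (cM M₀)) ((L : ℝ) ^ 2) m2)⁻¹ u x) b
            * (CDelta a 4 * Real.exp (-(kapA a 4 * (tdistT (cM M₀) (blockOf L (cM M₀) u) (blockOf L (cM M₀) v) / 3))))
            * blockSum L (cM M₀) (fun x => (lapF (fine L (cM M₀)) ((L : ℝ) ^ 2) m2)⁻¹ x v) b'
        + ((L : ℝ) ^ 4 * ((49 * (34016 + 10 / m2) / (L : ℝ) ^ 2) / (1 + tdistT (fine L (cM M₀)) u v ^ 2))) * |effLaplacian L (cM M₀) a ((L : ℝ) ^ 2) m2 b b'|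
            * blockSum L (cM M₀) (fun x => (lapF (fine L (cM M₀)) ((L : ℝ) ^ 2) m2)⁻¹ x v) b'
        + blockSum L (cM M₀) (fun x => (lapF (fine L (cM M₀)) ((L : ℝ) ^ 2) m2)⁻¹ u x) b * |effLaplacian L (cM M₀) a ((L : ℝ) ^ 2) m2 b b'|
            * ((L : ℝ) ^ 4 * ((49 * (34016 + 10 / m2) / (L : ℝ) ^ 2) / (1 + tdistT (fine L (cM M₀)) u v ^ 2))) := by
  have hc : (0 : ℝ) ≤ (L : ℝ) ^ 2 := by positivity
  set S := blockSum L (cM M₀) (fun x => (lapF (fine L (cM M₀)) ((L : ℝ) ^ 2) m2)⁻¹ u x) b with hS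
  set S' := blockSum L (cM M₀) (fun x => (lapF (fine L (cM M₀)) ((L : ℝ) ^ 2) m2)⁻¹ x v) b' with hS'
  set Δ := |effLaplacian L (cM M₀) a ((L : ℝ) ^ 2) m2 b b'| with hΔ
  set K := CDelta a 4 * Real.exp (-(kapA a 4 * (tdistT (cM M₀) (blockOf L (cM M₀) u) (blockOf L (cM M₀) v) / 3))) with hK
  set β := (L : ℝ) ^ 4 * ((49 * (34016 + 10 / m2) / (L : ℝ) ^ 2) / (1 + tdistT (fine L (cM M₀)) u v ^ 2)) with hβ
  have hS0 : 0 ≤ S := blockSum_lapF_inv_nonneg L (cM M₀) hc hm u b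
  have hS'0 : 0 ≤ S' := blockSum_lapF_inv_col_nonneg L (cM M₀) hc hm v b'
  have hΔ0 : 0 ≤ Δ := abs_nonneg _
  have hK0 : 0 ≤ K := mul_nonneg (CDelta_pos ha 4).le (Real.exp_pos _).le
  have hβ0 : 0 ≤ β := by positivity
  have hTA : 0 ≤ S * K * S' := by positivity
  have hTB : 0 ≤ β * Δ * S' := by positivity
  have hTC : 0 ≤ S * Δ * β := by positivity
  rcases exists_leg_ge_third (cM M₀) (blockOf L (cM M₀) u) (blockOf L (cM M₀) v) b b' with hA | hB | hC
  · -- leg (B): `dist(β_u, b) ≥ D∕3`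
    have h1 : S ≤ β := blockSum_lapF_inv_le_far L M₀ hm u v b hD hA
    have : S * Δ * S' ≤ β * Δ * S' := mul_le_mul_of_nonneg_right (mul_le_mul_of_nonneg_right h1 hΔ0) hS'0
    linarith
  · -- leg (A): `dist(b, b′) ≥ D∕3`
    have h1 : Δ ≤ K := abs_effLaplacian_le_far L M₀ ha hm b b' hB
    have : S * Δ * S' ≤ S * K * S' := mul_le_mul_of_nonneg_right (mul_le_mul_of_nonneg_left h1 hS0) hS'0
    linarith
  · -- leg (C): `dist(b′, β_v) ≥ D∕3`
    have h1 : S' ≤ β := blockSum_lapF_inv_col_le_far L M₀ hm u v b' hD hC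
    have : S * Δ * S' ≤ S * Δ * β := mul_le_mul_of_nonneg_left h1 (mul_nonneg hS0 hΔ0)
    linarith

/-- ★★★ **THE FAR DOUBLE SUM**: for `D = dist_M(β_u,β_v) ≥ 6`,
`Σ_{b,b′}S_u(b)|Δ_eff(b,b′)|S^v(b′) ≤ C_Δe^{−κ_AD∕3}∕m⁴ + 2·L⁴(49C₀∕(L²(1+dist(u,v)²)))·C_ΔS_κ∕m²` (`S_κ = latticeConst 4 κ_A`; totals `ΣS = 1∕m²` (Ϻ-a), row sums `Σ|Δ_eff| ≤ C_ΔS_κ` (Ϻ-b)).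
[cite: King1986, (4.34) p.674, (4.44)–(4.45) p.675; Balaban1983RegularityDecay, §5 p.600] -/
theorem abs_doubleSum_le_far (ha : 0 < a) (hm : 0 < m2) (u v : Tor (fine L (cM M₀))) (hD : 6 ≤ tdistT (cM M₀) (blockOf L (cM M₀) u) (blockOf L (cM M₀) v)) :
    ∑ b, ∑ b', blockSum L (cM M₀) (fun x => (lapF (fine L (cM M₀)) ((L : ℝ) ^ 2) m2)⁻¹ u x) b * |effLaplacian L (cM M₀) a ((L : ℝ) ^ 2) m2 b b'|
        * blockSum L (cM M₀) (fun x => (lapF (fine L (cM M₀)) ((L : ℝ) ^ 2) m2)⁻¹ x v) b'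
      ≤ CDelta a 4 * Real.exp (-(kapA a 4 * (tdistT (cM M₀) (blockOf L (cM M₀) u) (blockOf L (cM M₀) v) / 3))) / m2 ^ 2
        + 2 * (((L : ℝ) ^ 4 * ((49 * (34016 + 10 / m2) / (L : ℝ) ^ 2) / (1 + tdistT (fine L (cM M₀)) u v ^ 2)))
            * (CDelta a 4 * B4Sect5Proof.latticeConst 4 (kapA a 4)) / m2) := by
  have hc : (0 : ℝ) ≤ (L : ℝ) ^ 2 := by positivity
  set S := fun b => blockSum L (cM M₀) (fun x => (lapF (fine L (cM M₀)) ((L : ℝ) ^ 2) m2)⁻¹ u x) b with hS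
  set S' := fun b' => blockSum L (cM M₀) (fun x => (lapF (fine L (cM M₀)) ((L : ℝ) ^ 2) m2)⁻¹ x v) b' with hS'
  set Δ := fun b b' => |effLaplacian L (cM M₀) a ((L : ℝ) ^ 2) m2 b b'| with hΔ
  set K := CDelta a 4 * Real.exp (-(kapA a 4 * (tdistT (cM M₀) (blockOf L (cM M₀) u) (blockOf L (cM M₀) v) / 3))) with hK
  set β := (L : ℝ) ^ 4 * ((49 * (34016 + 10 / m2) / (L : ℝ) ^ 2) / (1 + tdistT (fine L (cM M₀)) u v ^ 2)) with hβ
  set CS := CDelta a 4 * B4Sect5Proof.latticeConst 4 (kapA a 4) with hCS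
  have hsumS : ∑ b, S b = m2⁻¹ := sum_blockSum_lapF_inv_row L (cM M₀) hc hm u
  have hsumS' : ∑ b', S' b' = m2⁻¹ := sum_blockSum_lapF_inv_col L (cM M₀) hc hm v
  have hS0 : ∀ b, 0 ≤ S b := fun b => blockSum_lapF_inv_nonneg L (cM M₀) hc hm u b
  have hS'0 : ∀ b', 0 ≤ S' b' := fun b' => blockSum_lapF_inv_col_nonneg L (cM M₀) hc hm v b'
  have hβ0 : 0 ≤ β := by positivity
  have hrow : ∀ b', ∑ b, Δ b b' ≤ CS := fun b' => sum_abs_effLaplacian_le L (cM M₀) ha hm b'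
  have hcol : ∀ b, ∑ b', Δ b b' ≤ CS := fun b => sum_abs_effLaplacian_le' L (cM M₀) ha hm b
  -- pointwise domination, summed
  have h1 : ∑ b, ∑ b', S b * Δ b b' * S' b' ≤ ∑ b, ∑ b', (S b * K * S' b' + β * Δ b b' * S' b' + S b * Δ b b' * β) :=
    Finset.sum_le_sum fun b _ => Finset.sum_le_sum fun b' _ => summand_le_three_terms L M₀ ha hm u v hD b b'
  -- the three totals
  have hA : ∑ b, ∑ b', S b * K * S' b' = K / m2 ^ 2 := by
    have e : ∑ b, ∑ b', S b * K * S' b' = K * (∑ b, S b) * (∑ b', S' b') := by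
      rw [mul_assoc, Finset.sum_mul_sum, Finset.mul_sum]
      refine Finset.sum_congr rfl fun b _ => ?_
      rw [Finset.mul_sum]
      exact Finset.sum_congr rfl fun b' _ => by ring
    rw [e, hsumS, hsumS']; field_simp
  have hB : ∑ b, ∑ b', β * Δ b b' * S' b' ≤ β * CS / m2 := by
    calc ∑ b, ∑ b', β * Δ b b' * S' b' = β * ∑ b', S' b' * (∑ b, Δ b b') := by
          rw [Finset.sum_comm, Finset.mul_sum]
          refine Finset.sum_congr rfl fun b' _ => ?_
          rw [Finset.mul_sum, Finset.mul_sum]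
          exact Finset.sum_congr rfl fun b _ => by ring
      _ ≤ β * ∑ b', S' b' * CS := by
          refine mul_le_mul_of_nonneg_left (Finset.sum_le_sum fun b' _ => mul_le_mul_of_nonneg_left (hrow b') (hS'0 b')) hβ0
      _ = β * CS / m2 := by rw [← Finset.sum_mul, hsumS']; field_simp
  have hC : ∑ b, ∑ b', S b * Δ b b' * β ≤ β * CS / m2 := by
    calc ∑ b, ∑ b', S b * Δ b b' * β = β * ∑ b, S b * (∑ b', Δ b b') := by
          rw [Finset.mul_sum]
          refine Finset.sum_congr rfl fun b _ => ?_
          rw [Finset.mul_sum, Finset.mul_sum]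
          exact Finset.sum_congr rfl fun b' _ => by ring
      _ ≤ β * ∑ b, S b * CS := by
          refine mul_le_mul_of_nonneg_left (Finset.sum_le_sum fun b _ => mul_le_mul_of_nonneg_left (hcol b) (hS0 b)) hβ0
      _ = β * CS / m2 := by rw [← Finset.sum_mul, hsumS]; field_simp
  have hsplit : ∑ b, ∑ b', (S b * K * S' b' + β * Δ b b' * S' b' + S b * Δ b b' * β)
      = (∑ b, ∑ b', S b * K * S' b') + (∑ b, ∑ b', β * Δ b b' * S' b') + (∑ b, ∑ b', S b * Δ b b' * β) := by
    rw [← Finset.sum_add_distrib, ← Finset.sum_add_distrib]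
    refine Finset.sum_congr rfl fun b _ => ?_
    rw [← Finset.sum_add_distrib, ← Finset.sum_add_distrib]
  calc ∑ b, ∑ b', S b * Δ b b' * S' b' ≤ _ := h1
    _ = _ := hsplit
    _ ≤ K / m2 ^ 2 + β * CS / m2 + β * CS / m2 := by rw [hA]; exact add_le_add (add_le_add le_rfl hB) hC
    _ = K / m2 ^ 2 + 2 * (β * CS / m2) := by ring

/-! ## §3 The far and near bounds for `L²|A₀⁻¹ − G|` -/

/-- ★★★ **THE FAR ZONE**: if the blocks of `u` and `v` are `D ≥ 6` apart then, for every `L ≥ 1`, every `M₀ ≥ 1`,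
`L²·|A₀⁻¹(u,v) − G(u,v)| ≤ (98·C₀·C_Δ·S_κ∕m² + 50·C_Δ∕(κ_A²·m⁴))∕(1 + dist(u,v)²)` (`C₀ = 34016+10∕m²`, `C_Δ = CDelta a 4`, `κ_A = kapA a 4`, `S_κ = latticeConst 4 κ_A`).
[cite: King1986, (2.13)–(2.14) p.653, (4.34) p.674, (4.44)–(4.45) p.675; Dimock2013, App. D Lemma 30] -/
theorem mul_abs_fineOp_inv_sub_lapF_inv_le_far (ha : 0 < a) (hm : 0 < m2) (u v : Tor (fine L (cM M₀)))
    (hD : 6 ≤ tdistT (cM M₀) (blockOf L (cM M₀) u) (blockOf L (cM M₀) v)) :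
    (L : ℝ) ^ 2 * |(fineOp L (cM M₀) a ((L : ℝ) ^ 2) m2)⁻¹ u v - (lapF (fine L (cM M₀)) ((L : ℝ) ^ 2) m2)⁻¹ u v|
      ≤ (98 * (34016 + 10 / m2) * (CDelta a 4 * B4Sect5Proof.latticeConst 4 (kapA a 4)) / m2 + 50 * CDelta a 4 / (kapA a 4 ^ 2 * m2 ^ 2))
          / (1 + tdistT (fine L (cM M₀)) u v ^ 2) := by
  have hL1 : (1 : ℝ) ≤ L := by exact_mod_cast Nat.one_le_iff_ne_zero.mpr (NeZero.ne L)
  have hL0 : (0 : ℝ) < L := by positivity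
  have hc : (0 : ℝ) ≤ (L : ℝ) ^ 2 := by positivity
  have ht0 := tdistT_nonneg (fine L (cM M₀)) u v
  have ht := tdistT_fine_le_blocks L (cM M₀) u v
  set t := tdistT (fine L (cM M₀)) u v with htdef
  set D := tdistT (cM M₀) (blockOf L (cM M₀) u) (blockOf L (cM M₀) v) with hDdef
  set C0 : ℝ := 34016 + 10 / m2 with hC0
  set CS := CDelta a 4 * B4Sect5Proof.latticeConst 4 (kapA a 4) with hCS
  have hC00 : 0 ≤ C0 := by positivity
  have hCD := (CDelta_pos ha 4).le
  have hCS0 : 0 ≤ CS := by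
    have := sum_abs_effLaplacian_le L (cM M₀) ha hm (blockOf L (cM M₀) u)
    exact le_trans (Finset.sum_nonneg fun _ _ => abs_nonneg _) this
  -- the entry formula and the far double sum
  have hentry := fineOp_inv_apply_eq L (cM M₀) ha.le hc hm u v
  have hsum := abs_doubleSum_le_far L M₀ ha hm u v hD
  have hL4 : ((L : ℝ) ^ (3 + 1))⁻¹ = ((L : ℝ) ^ 4)⁻¹ := by norm_num
  have habs : |(fineOp L (cM M₀) a ((L : ℝ) ^ 2) m2)⁻¹ u v - (lapF (fine L (cM M₀)) ((L : ℝ) ^ 2) m2)⁻¹ u v|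
      ≤ ((L : ℝ) ^ 4)⁻¹ * (CDelta a 4 * Real.exp (-(kapA a 4 * (D / 3))) / m2 ^ 2 + 2 * (((L : ℝ) ^ 4 * ((49 * C0 / (L : ℝ) ^ 2) / (1 + t ^ 2))) * CS / m2)) := by
    rw [hentry, sub_sub_cancel_left, abs_neg, abs_mul, hL4, abs_of_pos (by positivity : (0 : ℝ) < ((L : ℝ) ^ 4)⁻¹)]
    refine mul_le_mul_of_nonneg_left ?_ (by positivity)
    refine le_trans ((Finset.abs_sum_le_sum_abs _ _).trans (Finset.sum_le_sum fun b _ => (Finset.abs_sum_le_sum_abs _ _).trans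
      (Finset.sum_le_sum fun b' _ => le_of_eq ?_))) hsum
    rw [abs_mul, abs_mul, abs_of_nonneg (blockSum_lapF_inv_nonneg L (cM M₀) hc hm u b), abs_of_nonneg (blockSum_lapF_inv_col_nonneg L (cM M₀) hc hm v b')]
  -- the two conversions
  have htail := exp_tail_le_far hL1 hD ht0 ht (kapA_pos ha 4)
  have hκ2 : 0 < kapA a 4 ^ 2 := pow_pos (kapA_pos ha 4) 2
  have hm2 : 0 < m2 ^ 2 := by positivity
  calc (L : ℝ) ^ 2 * |(fineOp L (cM M₀) a ((L : ℝ) ^ 2) m2)⁻¹ u v - (lapF (fine L (cM M₀)) ((L : ℝ) ^ 2) m2)⁻¹ u v|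
      ≤ (L : ℝ) ^ 2 * (((L : ℝ) ^ 4)⁻¹ * (CDelta a 4 * Real.exp (-(kapA a 4 * (D / 3))) / m2 ^ 2 + 2 * (((L : ℝ) ^ 4 * ((49 * C0 / (L : ℝ) ^ 2) / (1 + t ^ 2))) * CS / m2))) :=
        mul_le_mul_of_nonneg_left habs hc
    _ = (CDelta a 4 / m2 ^ 2) * (Real.exp (-(kapA a 4 * (D / 3))) / (L : ℝ) ^ 2) + (98 * C0 * CS / m2) * (1 / (1 + t ^ 2)) := by
        field_simp; ring
    _ ≤ (CDelta a 4 / m2 ^ 2) * ((50 / kapA a 4 ^ 2) / (1 + t ^ 2)) + (98 * C0 * CS / m2) * (1 / (1 + t ^ 2)) := by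
        gcongr
    _ = (98 * C0 * CS / m2 + 50 * CDelta a 4 / (kapA a 4 ^ 2 * m2 ^ 2)) / (1 + t ^ 2) := by
        field_simp; ring

/-- ★★★ **THE NEAR ZONE**: if the blocks of `u` and `v` are `D < 6` apart then `L²·|A₀⁻¹(u,v) − G(u,v)| ≤ 50·C_Δ∕(m⁴·(1 + dist(u,v)²))` (Ϻ-a's `N^{−4}C_Δ∕m⁴` through Ϻ-b's `1∕L² ≤ 50∕(1+dist²)`).
[cite: King1986, (2.13)–(2.14) p.653, (4.34) p.674, (4.44)–(4.45) p.675] -/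
theorem mul_abs_fineOp_inv_sub_lapF_inv_le_near (ha : 0 < a) (hm : 0 < m2) (u v : Tor (fine L (cM M₀)))
    (hD : tdistT (cM M₀) (blockOf L (cM M₀) u) (blockOf L (cM M₀) v) < 6) :
    (L : ℝ) ^ 2 * |(fineOp L (cM M₀) a ((L : ℝ) ^ 2) m2)⁻¹ u v - (lapF (fine L (cM M₀)) ((L : ℝ) ^ 2) m2)⁻¹ u v|
      ≤ (50 * CDelta a 4 / m2 ^ 2) / (1 + tdistT (fine L (cM M₀)) u v ^ 2) := by
  have hL1 : (1 : ℝ) ≤ L := by exact_mod_cast Nat.one_le_iff_ne_zero.mpr (NeZero.ne L)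
  have hL0 : (0 : ℝ) < L := by positivity
  have ht0 := tdistT_nonneg (fine L (cM M₀)) u v
  have ht := tdistT_fine_le_blocks L (cM M₀) u v
  have hnear := abs_fineOp_inv_sub_lapF_inv_le_near L (cM M₀) ha hm u v
  have hconv := inv_sq_le_near hL1 hD ht0 ht
  have hL4 : ((L : ℝ) ^ (3 + 1))⁻¹ = ((L : ℝ) ^ 4)⁻¹ := by norm_num
  rw [hL4] at hnear
  have hCD := (CDelta_pos ha (3 + 1)).le
  calc (L : ℝ) ^ 2 * |(fineOp L (cM M₀) a ((L : ℝ) ^ 2) m2)⁻¹ u v - (lapF (fine L (cM M₀)) ((L : ℝ) ^ 2) m2)⁻¹ u v|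
      ≤ (L : ℝ) ^ 2 * (((L : ℝ) ^ 4)⁻¹ * (CDelta a (3 + 1) / m2 ^ 2)) := mul_le_mul_of_nonneg_left hnear (by positivity)
    _ = (CDelta a 4 / m2 ^ 2) * (1 / (L : ℝ) ^ 2) := by field_simp
    _ ≤ (CDelta a 4 / m2 ^ 2) * (50 / (1 + tdistT (fine L (cM M₀)) u v ^ 2)) := mul_le_mul_of_nonneg_left hconv (by positivity)
    _ = (50 * CDelta a 4 / m2 ^ 2) / (1 + tdistT (fine L (cM M₀)) u v ^ 2) := by ring

end Summit.QuantumFields.YangMills.BalabanUVNodes.N15KingModelRung.HeatKernel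

end
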